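import Literature.AlgebraicGeometry.HodgeTheory.FermatHodgeCharacterCriterion
import HarnessLib

/-!
# The Hodge condition at the sub-levels `m/2` (`m = 2m'`, `m'` odd) and `m/3` (`m = 3m'`, `3 ∤ m'`) — Aoki 1983, Prop. 2.2 at `f = m'`

Topic `Literature/AlgebraicGeometry/HodgeTheory`. THEOREMS only (no definition, no named fact, no `sorry`).
Support file for the uniform treatment of [Aoki1983, Thm. C] at the levels `m = 2m'` (route K₂:
`FermatSurfaceHodgeCharacterTwiceCoprimeSix`) and `m = 3m'` (route K₃) of the cell's scoping document.

For a Hodge character `α : Fin r → ℤ/m` and an odd primitive character `χ` mod `m'`, Aoki's criterion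
([Aoki1983, Prop. 2.1/2.2]; the tree's `IsHodge.aoki_criterion`, support file I) at the conductor `f = m'`
reads coordinate by coordinate (`ᾱᵢ = αᵢ mod m'`; coordinates sharing a prime with `m'` do not meet the
conductor):
* `m = 2m'`, `m'` odd — **`IsHodge.rel_half_level`**: a unit coordinate contributes `(1 - χ(2)⁻¹) χ(ᾱᵢ)`
  (Euler factor of `2 ∣ M = 2m'`), an even coordinate prime to `m'` contributes `χ(2)⁻¹ χ(ᾱᵢ)`
  (weight `φ(2m')/φ(m') = 1`); Aoki's "`τ₂(α) ∈ A(m')`", §9 (I-5), (II), (III-8), (III-10). With the twin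
  factor `v = -2⁻¹` the relation is `∑_{units} (χ(ᾱᵢ) + χ(vᾱᵢ)) - ∑_{even} χ(vᾱᵢ) = 0`.
* `m = 3m'`, `3 ∤ m'` — **`IsHodge.rel_third_level`**: a unit coordinate contributes `(1 - χ(3)⁻¹) χ(ᾱᵢ)`,
  a coordinate in `3·(ℤ/m)ˣ` contributes `2 χ(3)⁻¹ χ(ᾱᵢ)` (weight `φ(3m')/φ(m') = 2`); with `v₃ = -3⁻¹`:
  `∑_{units} (χ(ᾱᵢ) + χ(v₃ᾱᵢ)) - 2 ∑_{3·units} χ(v₃ᾱᵢ) = 0` — the same shape as at `2m'` up to the WEIGHT `2`.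

HONEST FRAMING (cell `pub-hfermat`): explicit algebraic cycles for specific Hodge classes on
Fermat/Delsarte varieties; residual open instances listed; no claim on general Hodge. (Surface classes
are algebraic by Lefschetz (1,1); this file is a relation among Hodge characters, no case of HC.)

## References
* [Aoki1983] N. Aoki, *On some arithmetic problems related to the Hodge cycles on the Fermat varieties*,
  Math. Ann. 266 (1983) 23–54 — Props. 2.1, 2.2 (the terms `L_ψ(αᵢ)`), §9 pp. 47–54.
-/

noncomputable section

open Finset

namespace Literature.AlgebraicGeometry.HodgeTheory

namespace FermatCharacter

/-! ### The Hodge condition at the level `m' = m/2` (Aoki's `τ₂(α) ∈ A(m')`, [Aoki1983, Prop. 2.2]) -/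

section HalfLevel

variable {n : ℕ} [NeZero n]

omit [NeZero n] in
/-- `2n ≠ 0`. [folklore] -/
private theorem two_mul_ne_zero' (hn0 : n ≠ 0) : 2 * n ≠ 0 := mul_ne_zero two_ne_zero hn0

/-- The reduction `ℤ/2n → ℤ/n` of `x` is the residue of `⟨x⟩`. [folklore] -/
private theorem castHom_half_eq_val (x : ZMod (2 * n)) :
    ZMod.castHom (dvd_mul_left n 2) (ZMod n) x = ((x.val : ℕ) : ZMod n) := by
  haveI : NeZero (2 * n) := ⟨two_mul_ne_zero' (NeZero.ne n)⟩
  conv_lhs => rw [← ZMod.natCast_zmod_val x]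
  rw [map_natCast]

omit [NeZero n] in
/-- For a unit `x` of `ℤ/2n`: `gcd(2n, ⟨x⟩) = 1`. [folklore] -/
private theorem gcd_eq_one_of_isUnit {x : ZMod (2 * n)} (hu : IsUnit x) :
    (2 * n).gcd x.val = 1 := by
  have h := ZMod.val_coe_unit_coprime hu.unit
  rw [IsUnit.unit_spec] at h
  rw [Nat.gcd_comm]
  exact h

/-- For a non-unit `x` of `ℤ/2n` (`n` odd) whose reduction mod `n` is a unit: `gcd(2n, ⟨x⟩) = 2`.
[folklore] -/
private theorem gcd_eq_two_of_not_isUnit {x : ZMod (2 * n)} (hu : ¬ IsUnit x)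
    (hu' : IsUnit (ZMod.castHom (dvd_mul_left n 2) (ZMod n) x)) : (2 * n).gcd x.val = 2 := by
  haveI : NeZero (2 * n) := ⟨two_mul_ne_zero' (NeZero.ne n)⟩
  rw [castHom_half_eq_val, ZMod.isUnit_iff_coprime] at hu'
  have hnot : ¬ x.val.Coprime (2 * n) := by
    intro hc
    apply hu
    rw [← ZMod.natCast_zmod_val x, ZMod.isUnit_iff_coprime]
    exact hc
  have hg : Nat.gcd x.val (2 * n) = Nat.gcd x.val 2 :=
    Nat.Coprime.gcd_mul_right_cancel_right 2 (Nat.coprime_comm.mp hu')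
  rw [Nat.gcd_comm, hg]
  have hd : Nat.gcd x.val 2 ∣ 2 := Nat.gcd_dvd_right _ _
  rcases (Nat.dvd_prime Nat.prime_two).mp hd with h1 | h2
  · exact absurd (Nat.coprime_iff_gcd_eq_one.mpr (by rw [hg, h1])) hnot
  · exact h2

/-- If the reduction of `x ∈ ℤ/2n` mod `n` (`n` odd) is NOT a unit, the level `2n/gcd(2n, ⟨x⟩)`
of `x` is not a multiple of `n`. [folklore] -/
private theorem not_dvd_level_of_not_isUnit (hn : Odd n) {x : ZMod (2 * n)}
    (hu' : ¬ IsUnit (ZMod.castHom (dvd_mul_left n 2) (ZMod n) x)) :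
    ¬ n ∣ 2 * n / (2 * n).gcd x.val := by
  haveI : NeZero (2 * n) := ⟨two_mul_ne_zero' (NeZero.ne n)⟩
  have hn0 : n ≠ 0 := NeZero.ne n
  rw [castHom_half_eq_val, ZMod.isUnit_iff_coprime] at hu'
  set g := (2 * n).gcd x.val with hg
  set d := Nat.gcd x.val n with hd
  have hd1 : d ≠ 1 := fun h1 ↦ hu' h1
  have hdg : d ∣ g := Nat.dvd_gcd ((Nat.gcd_dvd_right _ _).trans (dvd_mul_left n 2))
    (Nat.gcd_dvd_left _ _)
  have hdodd : Odd d := Odd.of_dvd_nat hn (Nat.gcd_dvd_right _ _)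
  intro h
  obtain ⟨t, ht⟩ := h
  have hgdvd : g ∣ 2 * n := Nat.gcd_dvd_left _ _
  have hmul : 2 * n / g * g = 2 * n := Nat.div_mul_cancel hgdvd
  rw [ht] at hmul
  -- `n t g = 2 n`, so `t g = 2` and `g ∣ 2`
  have htg : t * g = 2 := by
    have : n * (t * g) = n * 2 := by rw [← mul_assoc, hmul, mul_comm]
    exact Nat.eq_of_mul_eq_mul_left (Nat.pos_of_ne_zero hn0) this
  have hg2 : g ∣ 2 := ⟨t, by rw [mul_comm, htg]⟩
  have hd2 : d ∣ 2 := hdg.trans hg2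
  rcases (Nat.dvd_prime Nat.prime_two).mp hd2 with h | h
  · exact hd1 h
  · rw [h] at hdodd; exact absurd hdodd (by decide)

/-- The `i`-th term of Aoki's criterion at the level `n` for a coordinate `x ∈ ℤ/2n` (`n` odd),
written with the exact level `M = 2n/gcd(2n, ⟨x⟩)` and unit part `w` of `x`: it is
`(1 - χ(2)) χ(x̄)⁻¹` for a unit `x`, `χ(2) χ(x̄)⁻¹` for an even `x` prime to `n` (`x̄ = x mod n`),
and `0` when `x̄` is not a unit. [cite: Aoki1983, Prop. 2.1 and Prop. 2.2 (the terms `L_ψ(αᵢ)`)] -/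
private theorem half_term (hn : Odd n) (x : ZMod (2 * n))
    [NeZero (2 * n / (2 * n).gcd x.val)] (w : ZMod (2 * n / (2 * n).gcd x.val))
    (hwx : ((2 * n / (2 * n / (2 * n).gcd x.val) : ℕ) : ZMod (2 * n)) *
      ((w.val : ℕ) : ZMod (2 * n)) = x)
    (χ : DirichletCharacter ℂ n) :
    (if n ∣ 2 * n / (2 * n).gcd x.val then
        (((2 * n).totient : ℂ) / ((2 * n / (2 * n).gcd x.val).totient : ℂ)) *
          (∏ p ∈ (2 * n / (2 * n).gcd x.val).primeFactors, (1 - χ p)) *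
          (χ (ZMod.cast w : ZMod n))⁻¹ else 0) =
      if IsUnit x then (1 - χ 2) * (χ (ZMod.castHom (dvd_mul_left n 2) (ZMod n) x))⁻¹
      else if IsUnit (ZMod.castHom (dvd_mul_left n 2) (ZMod n) x) then
        χ 2 * (χ (ZMod.castHom (dvd_mul_left n 2) (ZMod n) x))⁻¹ else 0 := by
  classical
  have hn0 : n ≠ 0 := NeZero.ne n
  haveI : NeZero (2 * n) := ⟨two_mul_ne_zero' hn0⟩
  have h2n0 : 0 < 2 * n := Nat.pos_of_ne_zero (two_mul_ne_zero' hn0)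
  have hcop2n : Nat.Coprime 2 n := Nat.coprime_two_left.mpr hn
  set φ := ZMod.castHom (dvd_mul_left n 2) (ZMod n) with hφ
  -- the cast of `w` is the residue of `⟨w⟩`
  have hcw : (ZMod.cast w : ZMod n) = ((w.val : ℕ) : ZMod n) := ZMod.cast_eq_val w
  rw [hcw]
  -- `χ` vanishes on the primes of `n`
  have hprimes : ∀ q ∈ n.primeFactors, (1 - χ (q : ZMod n)) = 1 := by
    intro q hq
    have hqn : q ∣ n := Nat.dvd_of_mem_primeFactors hq
    have hq1 : q.Prime := Nat.prime_of_mem_primeFactors hq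
    have hnu : ¬ IsUnit ((q : ℕ) : ZMod n) := by
      rw [ZMod.isUnit_iff_coprime]
      intro hc
      exact hq1.one_lt.ne' (Nat.Coprime.eq_one_of_dvd hc hqn)
    rw [χ.map_nonunit hnu, sub_zero]
  have h2nmem : (2 : ℕ) ∉ n.primeFactors := fun h ↦
    (Nat.not_even_iff_odd.mpr hn) (even_iff_two_dvd.mpr (Nat.dvd_of_mem_primeFactors h))
  by_cases hu : IsUnit x
  · -- unit: `M = 2n`, `w = x`
    have hg1 : (2 * n).gcd x.val = 1 := gcd_eq_one_of_isUnit hu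
    have h1 : 2 * n / (2 * n / (2 * n).gcd x.val) = 1 := by
      rw [hg1, Nat.div_one, Nat.div_self h2n0]
    rw [h1, Nat.cast_one, one_mul] at hwx
    have hwφ : ((w.val : ℕ) : ZMod n) = φ x := by
      have := congrArg φ hwx
      rwa [map_natCast] at this
    rw [hwφ, if_pos hu]
    have hM : 2 * n / (2 * n).gcd x.val = 2 * n := by rw [hg1, Nat.div_one]
    rw [hM, if_pos (dvd_mul_left n 2), div_self (by exact_mod_cast (Nat.totient_pos.mpr h2n0).ne'),
      one_mul, Nat.primeFactors_mul two_ne_zero hn0, Nat.prime_two.primeFactors,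
      show ({2} ∪ n.primeFactors : Finset ℕ) = insert 2 n.primeFactors from rfl,
      Finset.prod_insert h2nmem, Finset.prod_eq_one hprimes, mul_one, Nat.cast_ofNat]
  · by_cases hu' : IsUnit (φ x)
    · -- even and prime to `n`: `M = n`, `2w ≡ x`
      have hg2 : (2 * n).gcd x.val = 2 := gcd_eq_two_of_not_isUnit hu hu'
      have hMn : 2 * n / (2 * n).gcd x.val = n := by
        rw [hg2, Nat.mul_div_cancel_left n two_pos]
      have h2 : 2 * n / (2 * n / (2 * n).gcd x.val) = 2 := by
        rw [hMn, Nat.mul_div_cancel 2 (Nat.pos_of_ne_zero hn0)]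
      rw [h2, Nat.cast_ofNat] at hwx
      have hwφ : (2 : ZMod n) * ((w.val : ℕ) : ZMod n) = φ x := by
        have := congrArg φ hwx
        rwa [map_mul, map_natCast, map_ofNat] at this
      -- `χ(w̄)⁻¹ = χ(2) χ(x̄)⁻¹`
      have h2u : IsUnit (2 : ZMod n) := by
        rw [show (2 : ZMod n) = ((2 : ℕ) : ZMod n) by norm_cast, ZMod.isUnit_iff_coprime]
        exact hcop2n
      have hχ2 : χ 2 ≠ 0 := fun h0 ↦ by
        have := DirichletCharacter.unit_norm_eq_one χ h2u.unit
        rw [IsUnit.unit_spec, h0, norm_zero] at this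
        exact zero_ne_one this
      have hval : (χ ((w.val : ℕ) : ZMod n))⁻¹ = χ 2 * (χ (φ x))⁻¹ := by
        rw [← hwφ, map_mul, mul_inv, ← mul_assoc, mul_inv_cancel₀ hχ2, one_mul]
      rw [hval, if_neg hu, if_pos hu', hMn, if_pos (dvd_refl n), Nat.totient_mul hcop2n,
        Nat.totient_two, one_mul,
        div_self (by exact_mod_cast (Nat.totient_pos.mpr (Nat.pos_of_ne_zero hn0)).ne'), one_mul,
        Finset.prod_eq_one hprimes, one_mul]
    · -- `x̄` not a unit: no term
      rw [if_neg (not_dvd_level_of_not_isUnit hn hu'), if_neg hu, if_neg hu']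

/-- **The Hodge condition at the level `m' = m/2`** for `m = 2m'`, `m'` odd ([Aoki1983, Prop. 2.2]
at `f = m'`, Aoki's "`τ₂(α) ∈ A(m')`", §9 (I-5), (II), (III-8), (III-10)): for a Hodge character
`α : Fin r → ℤ/2m'` and every odd primitive character `χ` mod `m'`,
`∑_{αᵢ unit} (1 - χ(2)⁻¹) χ(ᾱᵢ) + ∑_{αᵢ even, prime to m'} χ(2)⁻¹ χ(ᾱᵢ) = 0` (`ᾱᵢ = αᵢ mod m'`;
coordinates sharing an odd prime with `m'` do not contribute). With `v = -2⁻¹` the first sum is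
`∑ (χ(ᾱᵢ) + χ(v ᾱᵢ))` and the second `-∑ χ(v ᾱᵢ)`. [cite: Aoki1983, Prop. 2.2; §9 p. 48–51] -/
theorem IsHodge.rel_half_level (hn : Odd n) {r : ℕ} {α : Fin r → ZMod (2 * n)} (hα : IsHodge α)
    (χ : DirichletCharacter ℂ n) (hχ : χ.Odd) (hprim : χ.IsPrimitive) :
    ∑ i, (if IsUnit (α i) then
        (1 - (χ 2)⁻¹) * χ (ZMod.castHom (dvd_mul_left n 2) (ZMod n) (α i))
      else if IsUnit (ZMod.castHom (dvd_mul_left n 2) (ZMod n) (α i)) then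
        (χ 2)⁻¹ * χ (ZMod.castHom (dvd_mul_left n 2) (ZMod n) (α i)) else 0) = 0 := by
  classical
  have hn0 : n ≠ 0 := NeZero.ne n
  haveI : NeZero (2 * n) := ⟨two_mul_ne_zero' hn0⟩
  set φ := ZMod.castHom (dvd_mul_left n 2) (ZMod n) with hφ
  have H := fun i ↦ exists_unit_lift_eq (m := 2 * n) (α i)
  choose w hwu hwx using fun i ↦ (H i).2
  haveI : ∀ i, NeZero (2 * n / (2 * n).gcd (α i).val) := fun i ↦
    ⟨(Nat.div_pos (Nat.le_of_dvd (NeZero.pos (2 * n)) (Nat.gcd_dvd_left _ _))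
      (Nat.gcd_pos_of_pos_left _ (NeZero.pos (2 * n)))).ne'⟩
  have key := hα.aoki_criterion (dvd_mul_left n 2) hχ hprim
    (fun i ↦ 2 * n / (2 * n).gcd (α i).val) (fun i ↦ (H i).1) w hwu (fun i ↦ (hwx i).symm)
  have key' : ∑ i, (if IsUnit (α i) then (1 - χ 2) * (χ (φ (α i)))⁻¹
      else if IsUnit (φ (α i)) then χ 2 * (χ (φ (α i)))⁻¹ else 0) = 0 := by
    rw [Finset.sum_congr rfl fun i _ ↦ (half_term hn (α i) (w i) (hwx i) χ).symm]
    exact key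
  -- conjugate: `(χ y)⁻¹ = conj (χ y)`
  have hinv : ∀ y : ZMod n, (χ y)⁻¹ = starRingEnd ℂ (χ y) := by
    intro y
    by_cases hy : IsUnit y
    · exact Complex.inv_eq_conj (χ.unit_norm_eq_one hy.unit ▸ by rw [IsUnit.unit_spec])
    · rw [χ.map_nonunit hy, inv_zero, map_zero]
  have hterm : ∀ i, (if IsUnit (α i) then (1 - (χ 2)⁻¹) * χ (φ (α i))
      else if IsUnit (φ (α i)) then (χ 2)⁻¹ * χ (φ (α i)) else 0) =
      starRingEnd ℂ (if IsUnit (α i) then (1 - χ 2) * (χ (φ (α i)))⁻¹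
        else if IsUnit (φ (α i)) then χ 2 * (χ (φ (α i)))⁻¹ else 0) := by
    intro i
    by_cases hu : IsUnit (α i)
    · rw [if_pos hu, if_pos hu, map_mul, map_sub, map_one, map_inv₀, ← hinv, ← hinv, inv_inv]
    · by_cases hu' : IsUnit (φ (α i))
      · rw [if_neg hu, if_pos hu', if_neg hu, if_pos hu', map_mul, map_inv₀, ← hinv, ← hinv,
          inv_inv]
      · rw [if_neg hu, if_neg hu', if_neg hu, if_neg hu', map_zero]
  rw [Finset.sum_congr rfl fun i _ ↦ hterm i, ← map_sum, key', map_zero]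

end HalfLevel

/-! ### The Hodge condition at the level `m' = m/3` (Aoki's `τ₃(α) ∈ A(m')`, [Aoki1983, Prop. 2.2]) -/

section ThirdLevel

variable {n : ℕ} [NeZero n]

omit [NeZero n] in
/-- `3n ≠ 0`. [folklore] -/
private theorem three_mul_ne_zero' (hn0 : n ≠ 0) : 3 * n ≠ 0 := mul_ne_zero three_ne_zero hn0

/-- The reduction `ℤ/3n → ℤ/n` of `x` is the residue of `⟨x⟩`. [folklore] -/
private theorem castHom_third_eq_val (x : ZMod (3 * n)) :
    ZMod.castHom (dvd_mul_left n 3) (ZMod n) x = ((x.val : ℕ) : ZMod n) := by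
  haveI : NeZero (3 * n) := ⟨three_mul_ne_zero' (NeZero.ne n)⟩
  conv_lhs => rw [← ZMod.natCast_zmod_val x]
  rw [map_natCast]

omit [NeZero n] in
/-- For a unit `x` of `ℤ/3n`: `gcd(3n, ⟨x⟩) = 1`. [folklore] -/
private theorem gcd_eq_one_of_isUnit₃ {x : ZMod (3 * n)} (hu : IsUnit x) :
    (3 * n).gcd x.val = 1 := by
  have h := ZMod.val_coe_unit_coprime hu.unit
  rw [IsUnit.unit_spec] at h
  rw [Nat.gcd_comm]
  exact h

/-- For a non-unit `x` of `ℤ/3n` (`3 ∤ n`) whose reduction mod `n` is a unit: `gcd(3n, ⟨x⟩) = 3`.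
[folklore] -/
private theorem gcd_eq_three_of_not_isUnit {x : ZMod (3 * n)} (hu : ¬ IsUnit x)
    (hu' : IsUnit (ZMod.castHom (dvd_mul_left n 3) (ZMod n) x)) : (3 * n).gcd x.val = 3 := by
  haveI : NeZero (3 * n) := ⟨three_mul_ne_zero' (NeZero.ne n)⟩
  rw [castHom_third_eq_val, ZMod.isUnit_iff_coprime] at hu'
  have hnot : ¬ x.val.Coprime (3 * n) := by
    intro hc
    apply hu
    rw [← ZMod.natCast_zmod_val x, ZMod.isUnit_iff_coprime]
    exact hc
  have hg : Nat.gcd x.val (3 * n) = Nat.gcd x.val 3 :=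
    Nat.Coprime.gcd_mul_right_cancel_right 3 (Nat.coprime_comm.mp hu')
  rw [Nat.gcd_comm, hg]
  have hd : Nat.gcd x.val 3 ∣ 3 := Nat.gcd_dvd_right _ _
  rcases (Nat.dvd_prime Nat.prime_three).mp hd with h1 | h3
  · exact absurd (Nat.coprime_iff_gcd_eq_one.mpr (by rw [hg, h1])) hnot
  · exact h3

/-- If the reduction of `x ∈ ℤ/3n` mod `n` (`3 ∤ n`) is NOT a unit, the level `3n/gcd(3n, ⟨x⟩)`
of `x` is not a multiple of `n`. [folklore] -/
private theorem not_dvd_level_of_not_isUnit₃ (hn3 : Nat.Coprime 3 n) {x : ZMod (3 * n)}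
    (hu' : ¬ IsUnit (ZMod.castHom (dvd_mul_left n 3) (ZMod n) x)) :
    ¬ n ∣ 3 * n / (3 * n).gcd x.val := by
  haveI : NeZero (3 * n) := ⟨three_mul_ne_zero' (NeZero.ne n)⟩
  have hn0 : n ≠ 0 := NeZero.ne n
  rw [castHom_third_eq_val, ZMod.isUnit_iff_coprime] at hu'
  set g := (3 * n).gcd x.val with hg
  set d := Nat.gcd x.val n with hd
  have hd1 : d ≠ 1 := fun h1 ↦ hu' h1
  have hdg : d ∣ g := Nat.dvd_gcd ((Nat.gcd_dvd_right _ _).trans (dvd_mul_left n 3))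
    (Nat.gcd_dvd_left _ _)
  have hdn : d ∣ n := Nat.gcd_dvd_right _ _
  intro h
  obtain ⟨t, ht⟩ := h
  have hgdvd : g ∣ 3 * n := Nat.gcd_dvd_left _ _
  have hmul : 3 * n / g * g = 3 * n := Nat.div_mul_cancel hgdvd
  rw [ht] at hmul
  -- `n t g = 3 n`, so `t g = 3` and `g ∣ 3`
  have htg : t * g = 3 := by
    have : n * (t * g) = n * 3 := by rw [← mul_assoc, hmul, mul_comm]
    exact Nat.eq_of_mul_eq_mul_left (Nat.pos_of_ne_zero hn0) this
  have hg3 : g ∣ 3 := ⟨t, by rw [mul_comm, htg]⟩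
  have hd3 : d ∣ 3 := hdg.trans hg3
  have hd' : d ∣ Nat.gcd 3 n := Nat.dvd_gcd hd3 hdn
  rw [Nat.Coprime.gcd_eq_one hn3] at hd'
  exact hd1 (Nat.dvd_one.mp hd')

/-- The `i`-th term of Aoki's criterion at the level `n` for a coordinate `x ∈ ℤ/3n` (`3 ∤ n`),
written with the exact level `M = 3n/gcd(3n, ⟨x⟩)` and unit part `w` of `x`: it is
`(1 - χ(3)) χ(x̄)⁻¹` for a unit `x`, `2 χ(3) χ(x̄)⁻¹` for `x ∈ 3·(units)` with `x̄ = x mod n` a unit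
(weight `φ(3n)/φ(n) = 2`), and `0` when `x̄` is not a unit.
[cite: Aoki1983, Prop. 2.1 and Prop. 2.2 (the terms `L_ψ(αᵢ)`)] -/
private theorem third_term (hn3 : Nat.Coprime 3 n) (x : ZMod (3 * n))
    [NeZero (3 * n / (3 * n).gcd x.val)] (w : ZMod (3 * n / (3 * n).gcd x.val))
    (hwx : ((3 * n / (3 * n / (3 * n).gcd x.val) : ℕ) : ZMod (3 * n)) *
      ((w.val : ℕ) : ZMod (3 * n)) = x)
    (χ : DirichletCharacter ℂ n) :
    (if n ∣ 3 * n / (3 * n).gcd x.val then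
        (((3 * n).totient : ℂ) / ((3 * n / (3 * n).gcd x.val).totient : ℂ)) *
          (∏ p ∈ (3 * n / (3 * n).gcd x.val).primeFactors, (1 - χ p)) *
          (χ (ZMod.cast w : ZMod n))⁻¹ else 0) =
      if IsUnit x then (1 - χ 3) * (χ (ZMod.castHom (dvd_mul_left n 3) (ZMod n) x))⁻¹
      else if IsUnit (ZMod.castHom (dvd_mul_left n 3) (ZMod n) x) then
        2 * χ 3 * (χ (ZMod.castHom (dvd_mul_left n 3) (ZMod n) x))⁻¹ else 0 := by
  classical
  have hn0 : n ≠ 0 := NeZero.ne n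
  haveI : NeZero (3 * n) := ⟨three_mul_ne_zero' hn0⟩
  have h3n0 : 0 < 3 * n := Nat.pos_of_ne_zero (three_mul_ne_zero' hn0)
  set φ := ZMod.castHom (dvd_mul_left n 3) (ZMod n) with hφ
  -- the cast of `w` is the residue of `⟨w⟩`
  have hcw : (ZMod.cast w : ZMod n) = ((w.val : ℕ) : ZMod n) := ZMod.cast_eq_val w
  rw [hcw]
  -- `χ` vanishes on the primes of `n`
  have hprimes : ∀ q ∈ n.primeFactors, (1 - χ (q : ZMod n)) = 1 := by
    intro q hq
    have hqn : q ∣ n := Nat.dvd_of_mem_primeFactors hq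
    have hq1 : q.Prime := Nat.prime_of_mem_primeFactors hq
    have hnu : ¬ IsUnit ((q : ℕ) : ZMod n) := by
      rw [ZMod.isUnit_iff_coprime]
      intro hc
      exact hq1.one_lt.ne' (Nat.Coprime.eq_one_of_dvd hc hqn)
    rw [χ.map_nonunit hnu, sub_zero]
  have h3nmem : (3 : ℕ) ∉ n.primeFactors := fun h ↦ by
    have h3 : 3 ∣ n := Nat.dvd_of_mem_primeFactors h
    have : (3 : ℕ) ∣ Nat.gcd 3 n := Nat.dvd_gcd (dvd_refl 3) h3
    rw [Nat.Coprime.gcd_eq_one hn3] at this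
    exact absurd this (by norm_num)
  by_cases hu : IsUnit x
  · -- unit: `M = 3n`, `w = x`
    have hg1 : (3 * n).gcd x.val = 1 := gcd_eq_one_of_isUnit₃ hu
    have h1 : 3 * n / (3 * n / (3 * n).gcd x.val) = 1 := by
      rw [hg1, Nat.div_one, Nat.div_self h3n0]
    rw [h1, Nat.cast_one, one_mul] at hwx
    have hwφ : ((w.val : ℕ) : ZMod n) = φ x := by
      have := congrArg φ hwx
      rwa [map_natCast] at this
    rw [hwφ, if_pos hu]
    have hM : 3 * n / (3 * n).gcd x.val = 3 * n := by rw [hg1, Nat.div_one]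
    rw [hM, if_pos (dvd_mul_left n 3), div_self (by exact_mod_cast (Nat.totient_pos.mpr h3n0).ne'),
      one_mul, Nat.primeFactors_mul three_ne_zero hn0, Nat.prime_three.primeFactors,
      show ({3} ∪ n.primeFactors : Finset ℕ) = insert 3 n.primeFactors from rfl,
      Finset.prod_insert h3nmem, Finset.prod_eq_one hprimes, mul_one, Nat.cast_ofNat]
  · by_cases hu' : IsUnit (φ x)
    · -- `x ∈ 3·units`: `M = n`, `3w ≡ x`
      have hg3 : (3 * n).gcd x.val = 3 := gcd_eq_three_of_not_isUnit hu hu'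
      have hMn : 3 * n / (3 * n).gcd x.val = n := by
        rw [hg3, Nat.mul_div_cancel_left n three_pos]
      have h3 : 3 * n / (3 * n / (3 * n).gcd x.val) = 3 := by
        rw [hMn, Nat.mul_div_cancel 3 (Nat.pos_of_ne_zero hn0)]
      rw [h3, Nat.cast_ofNat] at hwx
      have hwφ : (3 : ZMod n) * ((w.val : ℕ) : ZMod n) = φ x := by
        have := congrArg φ hwx
        rwa [map_mul, map_natCast, map_ofNat] at this
      -- `χ(w̄)⁻¹ = χ(3) χ(x̄)⁻¹`
      have h3u : IsUnit (3 : ZMod n) := by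
        rw [show (3 : ZMod n) = ((3 : ℕ) : ZMod n) by norm_cast, ZMod.isUnit_iff_coprime]
        exact hn3
      have hχ3 : χ 3 ≠ 0 := fun h0 ↦ by
        have := DirichletCharacter.unit_norm_eq_one χ h3u.unit
        rw [IsUnit.unit_spec, h0, norm_zero] at this
        exact zero_ne_one this
      have hval : (χ ((w.val : ℕ) : ZMod n))⁻¹ = χ 3 * (χ (φ x))⁻¹ := by
        rw [← hwφ, map_mul, mul_inv, ← mul_assoc, mul_inv_cancel₀ hχ3, one_mul]
      rw [hval, if_neg hu, if_pos hu', hMn, if_pos (dvd_refl n), Nat.totient_mul hn3,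
        Nat.totient_prime Nat.prime_three,
        Finset.prod_eq_one hprimes, mul_one]
      have hφn : ((n.totient : ℕ) : ℂ) ≠ 0 := by
        exact_mod_cast (Nat.totient_pos.mpr (Nat.pos_of_ne_zero hn0)).ne'
      push_cast
      field_simp
    · -- `x̄` not a unit: no term
      rw [if_neg (not_dvd_level_of_not_isUnit₃ hn3 hu'), if_neg hu, if_neg hu']

/-- **The Hodge condition at the level `m' = m/3`** for `m = 3m'`, `3 ∤ m'` ([Aoki1983, Prop. 2.2] at
`f = m'`; Aoki's "`τ₃(α) ∈ A(m')`" in §9): for a Hodge character `α : Fin r → ℤ/3m'` and every odd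
primitive character `χ` mod `m'`,
`∑_{αᵢ unit} (1 - χ(3)⁻¹) χ(ᾱᵢ) + 2 ∑_{αᵢ ∈ 3(ℤ/m)ˣ} χ(3)⁻¹ χ(ᾱᵢ) = 0` (`ᾱᵢ = αᵢ mod m'`; coordinates
sharing a prime with `m'` do not contribute). With `v₃ = -3⁻¹` the first sum is `∑ (χ(ᾱᵢ) + χ(v₃ ᾱᵢ))`
and the second `-2 ∑ χ(v₃ ᾱᵢ)`. [cite: Aoki1983, Prop. 2.2; §9 pp. 47–54] -/
theorem IsHodge.rel_third_level (hn3 : Nat.Coprime 3 n) {r : ℕ} {α : Fin r → ZMod (3 * n)}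
    (hα : IsHodge α) (χ : DirichletCharacter ℂ n) (hχ : χ.Odd) (hprim : χ.IsPrimitive) :
    ∑ i, (if IsUnit (α i) then
        (1 - (χ 3)⁻¹) * χ (ZMod.castHom (dvd_mul_left n 3) (ZMod n) (α i))
      else if IsUnit (ZMod.castHom (dvd_mul_left n 3) (ZMod n) (α i)) then
        2 * (χ 3)⁻¹ * χ (ZMod.castHom (dvd_mul_left n 3) (ZMod n) (α i)) else 0) = 0 := by
  classical
  have hn0 : n ≠ 0 := NeZero.ne n
  haveI : NeZero (3 * n) := ⟨three_mul_ne_zero' hn0⟩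
  set φ := ZMod.castHom (dvd_mul_left n 3) (ZMod n) with hφ
  have H := fun i ↦ exists_unit_lift_eq (m := 3 * n) (α i)
  choose w hwu hwx using fun i ↦ (H i).2
  haveI : ∀ i, NeZero (3 * n / (3 * n).gcd (α i).val) := fun i ↦
    ⟨(Nat.div_pos (Nat.le_of_dvd (NeZero.pos (3 * n)) (Nat.gcd_dvd_left _ _))
      (Nat.gcd_pos_of_pos_left _ (NeZero.pos (3 * n)))).ne'⟩
  have key := hα.aoki_criterion (dvd_mul_left n 3) hχ hprim
    (fun i ↦ 3 * n / (3 * n).gcd (α i).val) (fun i ↦ (H i).1) w hwu (fun i ↦ (hwx i).symm)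
  have key' : ∑ i, (if IsUnit (α i) then (1 - χ 3) * (χ (φ (α i)))⁻¹
      else if IsUnit (φ (α i)) then 2 * χ 3 * (χ (φ (α i)))⁻¹ else 0) = 0 := by
    rw [Finset.sum_congr rfl fun i _ ↦ (third_term hn3 (α i) (w i) (hwx i) χ).symm]
    exact key
  -- conjugate: `(χ y)⁻¹ = conj (χ y)`
  have hinv : ∀ y : ZMod n, (χ y)⁻¹ = starRingEnd ℂ (χ y) := by
    intro y
    by_cases hy : IsUnit y
    · exact Complex.inv_eq_conj (χ.unit_norm_eq_one hy.unit ▸ by rw [IsUnit.unit_spec])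
    · rw [χ.map_nonunit hy, inv_zero, map_zero]
  have hterm : ∀ i, (if IsUnit (α i) then (1 - (χ 3)⁻¹) * χ (φ (α i))
      else if IsUnit (φ (α i)) then 2 * (χ 3)⁻¹ * χ (φ (α i)) else 0) =
      starRingEnd ℂ (if IsUnit (α i) then (1 - χ 3) * (χ (φ (α i)))⁻¹
        else if IsUnit (φ (α i)) then 2 * χ 3 * (χ (φ (α i)))⁻¹ else 0) := by
    intro i
    by_cases hu : IsUnit (α i)
    · rw [if_pos hu, if_pos hu, map_mul, map_sub, map_one, map_inv₀, ← hinv, ← hinv, inv_inv]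
    · by_cases hu' : IsUnit (φ (α i))
      · have c2 : starRingEnd ℂ (2 : ℂ) = 2 := map_ofNat _ 2
        rw [if_neg hu, if_pos hu', if_neg hu, if_pos hu', map_mul, map_mul, map_inv₀, c2, ← hinv,
          ← hinv, inv_inv]
      · rw [if_neg hu, if_neg hu', if_neg hu, if_neg hu', map_zero]
  rw [Finset.sum_congr rfl fun i _ ↦ hterm i, ← map_sum, key', map_zero]

end ThirdLevel

end FermatCharacter

end Literature.AlgebraicGeometry.HodgeTheory
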